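import Literature.Geometry.Lorentzian.KerrPrincipalFrameCurvature
import Literature.Geometry.Lorentzian.KerrPrincipalFrameCurvatureII
import HarnessLib

/-!
# The Kerr curvature tensor in the rational principal frame, III: the full lowered tables

Infrastructure (all results proved, no definitions) for the curvature invariants of the Kerr metric
(Kretschmann scalar, cubic invariant `48 M³ Re (r + iaμ)⁹/Σ⁹`; fact stubs F3/F4 of crux
`TameCensorship`), continuing `KerrPrincipalFrameCurvature{,II}.lean`. In ingoing Kerr coordinates
`u = (t*, r, μ, φ)` let `𝔣 = (l, n, e₃, e₄)` be the rational principal frame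
(`l = (r² + 2Mr + a²)∂_{t*} + Δ∂_r + 2a∂_φ`, `n = ∂_{t*} − ∂_r`, `e₃ = (1 − μ²)∂_μ`,
`e₄ = a(1 − μ²)∂_{t*} + ∂_φ`; Gram matrix `g(l,n) = −2Σ`, `g(e₃,e₃) = g(e₄,e₄) = Σ(1 − μ²)`), and write
`A = M(r³ − 3ra²μ²)`, `B = M(3r²aμ − a³μ³)`, so that `A + iB = M (r + iaμ)³ = −Σ³ Ψ₂`,
`Ψ₂ = −M/(r − iaμ)³` (Chandrasekhar 1983, §58). For each of the six pairs `f_I, f_J` (`I < J`) this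
file records the FULL `4 × 4` table `(k, q) ↦ g(R(f_I,f_J) f_q, f_k)` of lowered frame components
(`Kerr.Ingoing.pf_low_ln`, `…_l3`, `…_l4`, `…_n3`, `…_n4`, `…_34`), assembled from the 21 independent
components of `KerrPrincipalFrameCurvature{,II}.lean` by the symmetries of the curvature tensor
(skew-adjointness `MetricCoord.IsMetricOn.apply_riemAt_swap`, `Kerr.Ingoing.apply_riemAt_diag`, pair symmetry
`MetricCoord.IsMetricOn.apply_riemAt_pair_comm`; O'Neill 1983, Ch. 3, Prop. 3.36). The result is the
Petrov type D pattern of Kerr in its principal frame (Kinnersley 1969): the only nonzero entries are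

  `g(R(l,n)n,l) = −8A/Σ`,  `g(R(l,n)e₄,e₃) = g(R(e₃,e₄)n,l) = 4B(1−μ²)/Σ`,
  `g(R(l,e₃)e₃,n) = g(R(l,e₄)e₄,n) = g(R(n,e₃)e₃,l) = g(R(n,e₄)e₄,l) = 2A(1−μ²)/Σ`,
  `g(R(l,e₃)e₄,n) = −g(R(l,e₄)e₃,n) = −g(R(n,e₃)e₄,l) = g(R(n,e₄)e₃,l) = 2B(1−μ²)/Σ`,
  `g(R(e₃,e₄)e₄,e₃) = 2A(1−μ²)²/Σ`

and their skew partners — the input of trace computations in the frame (cubic invariant of Kerr).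
Everything is checked by Lean from the cited inputs. No definitions are introduced: the tables are
stated for any family `𝔣 : Fin 4 → E4` equal to the frame (e.g. `Kerr.Ingoing.exists_frameBasis`).

## References

* R. P. Kerr, Phys. Rev. Lett. 11 (1963) 237–238; R. P. Kerr, A. Schild, *A new class of vacuum
  solutions of the Einstein field equations* (1965), §3. [KerrSchild1965]
* W. Kinnersley, *Type D vacuum metrics*, J. Math. Phys. 10 (1969) 1195.
* S. Chandrasekhar, *The mathematical theory of black holes* (1983), §58.
* B. O'Neill, *Semi-Riemannian geometry* (1983), Ch. 3, Prop. 3.36. [ONeill1983]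
-/

noncomputable section

set_option maxSynthPendingDepth 3

open Set Function Module
open scoped ContDiff Topology
open Literature.Geometry.Lorentzian.MetricCoord

namespace Literature.Geometry.Lorentzian

namespace Kerr

namespace Ingoing

variable (M a : ℝ) {u : E4}


/-- **Full table of lowered frame components of `R(l,n)`**: `g(R(f_0,f_1) f_q, f_k)` (rows `k`,
columns `q`) in the principal frame `(f_0, f_1, f_2, f_3) = (l, n, e₃, e₄)` of Kerr, ingoing Kerr
coordinates (`r = u 1`, `μ = u 2`), by the curvature symmetries. [cite: ONeill1983, Ch. 3, Prop. 3.36] -/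
theorem pf_low_ln (hu : u ∈ regularSet a) (𝔣 : Fin 4 → E4)
    (h0 : 𝔣 0 =
      (!₂[u 1 ^ 2 + 2 * M * u 1 + a ^ 2, u 1 ^ 2 - 2 * M * u 1 + a ^ 2, (0 : ℝ), 2 * a] : E4))
    (h1 : 𝔣 1 = (!₂[(1 : ℝ), -1, 0, 0] : E4)) (h2 : 𝔣 2 = (!₂[(0 : ℝ), 0, 1 - u 2 ^ 2, 0] : E4))
    (h3 : 𝔣 3 = (!₂[a * (1 - u 2 ^ 2), (0 : ℝ), 0, 1] : E4)) (k q : Fin 4) :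
    bilin M a u (riemAt (bilin M a) u (𝔣 0) (𝔣 1) (𝔣 q)) (𝔣 k) =
      (!![0, -(8 * M * (u 1 ^ (3 : ℕ) - 3 * u 1 * a ^ (2 : ℕ) * u 2 ^ (2 : ℕ))) / sigma a u, 0, 0;
        8 * M * (u 1 ^ (3 : ℕ) - 3 * u 1 * a ^ (2 : ℕ) * u 2 ^ (2 : ℕ)) / sigma a u, 0, 0, 0;
        0, 0, 0,
          4 * M * (3 * u 1 ^ (2 : ℕ) * a * u 2 - a ^ (3 : ℕ) * u 2 ^ (3 : ℕ)) * (1 - u 2 ^ (2 : ℕ)) / sigma a u;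
        0, 0,
          -(4 * M * (3 * u 1 ^ (2 : ℕ) * a * u 2 - a ^ (3 : ℕ) * u 2 ^ (3 : ℕ)) * (1 - u 2 ^ (2 : ℕ))) / sigma a u,
          0] : Matrix (Fin 4) (Fin 4) ℝ) k q := by
  have hsk := (isMetricOn_bilin M a).apply_riemAt_swap hu
  fin_cases k <;> fin_cases q <;>
    simp only [Fin.zero_eta, Fin.mk_one, Fin.reduceFinMk, Fin.isValue, Matrix.of_apply,
      Matrix.cons_val', Matrix.cons_val_zero, Matrix.cons_val_one, Matrix.cons_val,
      Matrix.empty_val', Matrix.cons_val_fin_one]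
  · exact apply_riemAt_diag M a hu _ _ _
  · rw [h0, h1]; linear_combination pf_riem_ln_ln M a hu
  · rw [h0, h1, h2]; linear_combination pf_riem_ln_l3 M a hu
  · rw [h0, h1, h3]; linear_combination pf_riem_ln_l4 M a hu
  · rw [hsk (𝔣 0) (𝔣 1) (𝔣 1) (𝔣 0), h0, h1]; linear_combination -pf_riem_ln_ln M a hu
  · exact apply_riemAt_diag M a hu _ _ _
  · rw [h0, h1, h2]; linear_combination pf_riem_ln_n3 M a hu
  · rw [h0, h1, h3]; linear_combination pf_riem_ln_n4 M a hu
  · rw [hsk (𝔣 0) (𝔣 1) (𝔣 2) (𝔣 0), h0, h1, h2]; linear_combination -pf_riem_ln_l3 M a hu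
  · rw [hsk (𝔣 0) (𝔣 1) (𝔣 2) (𝔣 1), h0, h1, h2]; linear_combination -pf_riem_ln_n3 M a hu
  · exact apply_riemAt_diag M a hu _ _ _
  · rw [h0, h1, h2, h3]; linear_combination pf_riem_ln_34 M a hu
  · rw [hsk (𝔣 0) (𝔣 1) (𝔣 3) (𝔣 0), h0, h1, h3]; linear_combination -pf_riem_ln_l4 M a hu
  · rw [hsk (𝔣 0) (𝔣 1) (𝔣 3) (𝔣 1), h0, h1, h3]; linear_combination -pf_riem_ln_n4 M a hu
  · rw [hsk (𝔣 0) (𝔣 1) (𝔣 3) (𝔣 2), h0, h1, h2, h3]; linear_combination -pf_riem_ln_34 M a hu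
  · exact apply_riemAt_diag M a hu _ _ _

/-- **Full table of lowered frame components of `R(l,e₃)`**: `g(R(f_0,f_2) f_q, f_k)` (rows `k`,
columns `q`) in the principal frame `(f_0, f_1, f_2, f_3) = (l, n, e₃, e₄)` of Kerr, ingoing Kerr
coordinates (`r = u 1`, `μ = u 2`), by the curvature symmetries. [cite: ONeill1983, Ch. 3, Prop. 3.36] -/
theorem pf_low_l3 (hu : u ∈ regularSet a) (𝔣 : Fin 4 → E4)
    (h0 : 𝔣 0 =
      (!₂[u 1 ^ 2 + 2 * M * u 1 + a ^ 2, u 1 ^ 2 - 2 * M * u 1 + a ^ 2, (0 : ℝ), 2 * a] : E4))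
    (h1 : 𝔣 1 = (!₂[(1 : ℝ), -1, 0, 0] : E4)) (h2 : 𝔣 2 = (!₂[(0 : ℝ), 0, 1 - u 2 ^ 2, 0] : E4))
    (h3 : 𝔣 3 = (!₂[a * (1 - u 2 ^ 2), (0 : ℝ), 0, 1] : E4)) (k q : Fin 4) :
    bilin M a u (riemAt (bilin M a) u (𝔣 0) (𝔣 2) (𝔣 q)) (𝔣 k) =
      (!![0, 0, 0, 0;
        0, 0,
          2 * M * (u 1 ^ (3 : ℕ) - 3 * u 1 * a ^ (2 : ℕ) * u 2 ^ (2 : ℕ)) * (1 - u 2 ^ (2 : ℕ)) / sigma a u,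
          2 * M * (3 * u 1 ^ (2 : ℕ) * a * u 2 - a ^ (3 : ℕ) * u 2 ^ (3 : ℕ)) * (1 - u 2 ^ (2 : ℕ)) / sigma a u;
        0,
          -(2 * M * (u 1 ^ (3 : ℕ) - 3 * u 1 * a ^ (2 : ℕ) * u 2 ^ (2 : ℕ)) * (1 - u 2 ^ (2 : ℕ))) / sigma a u,
          0, 0;
        0,
          -(2 * M * (3 * u 1 ^ (2 : ℕ) * a * u 2 - a ^ (3 : ℕ) * u 2 ^ (3 : ℕ)) * (1 - u 2 ^ (2 : ℕ))) / sigma a u,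
          0, 0] : Matrix (Fin 4) (Fin 4) ℝ) k q := by
  have hsk := (isMetricOn_bilin M a).apply_riemAt_swap hu
  have hpc := (isMetricOn_bilin M a).apply_riemAt_pair_comm hu
  fin_cases k <;> fin_cases q <;>
    simp only [Fin.zero_eta, Fin.mk_one, Fin.reduceFinMk, Fin.isValue, Matrix.of_apply,
      Matrix.cons_val', Matrix.cons_val_zero, Matrix.cons_val_one, Matrix.cons_val,
      Matrix.empty_val', Matrix.cons_val_fin_one]
  · exact apply_riemAt_diag M a hu _ _ _
  · rw [hpc (𝔣 0) (𝔣 2) (𝔣 1) (𝔣 0), riemAt_swap (bilin M a) u (𝔣 0) (𝔣 1), neg_apply, map_neg,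
      neg_apply, hsk (𝔣 0) (𝔣 1) (𝔣 2) (𝔣 0), neg_neg, h0, h1, h2]
    linear_combination pf_riem_ln_l3 M a hu
  · rw [h0, h2]; linear_combination pf_riem_l3_l3 M a hu
  · rw [h0, h2, h3]; linear_combination pf_riem_l3_l4 M a hu
  · rw [hsk (𝔣 0) (𝔣 2) (𝔣 1) (𝔣 0), hpc (𝔣 0) (𝔣 2) (𝔣 1) (𝔣 0),
      riemAt_swap (bilin M a) u (𝔣 0) (𝔣 1), neg_apply, map_neg, neg_apply,
      hsk (𝔣 0) (𝔣 1) (𝔣 2) (𝔣 0), neg_neg, h0, h1, h2]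
    linear_combination -pf_riem_ln_l3 M a hu
  · exact apply_riemAt_diag M a hu _ _ _
  · rw [h0, h1, h2]; linear_combination pf_riem_l3_n3 M a hu
  · rw [h0, h1, h2, h3]; linear_combination pf_riem_l3_n4 M a hu
  · rw [hsk (𝔣 0) (𝔣 2) (𝔣 2) (𝔣 0), h0, h2]; linear_combination -pf_riem_l3_l3 M a hu
  · rw [hsk (𝔣 0) (𝔣 2) (𝔣 2) (𝔣 1), h0, h1, h2]; linear_combination -pf_riem_l3_n3 M a hu
  · exact apply_riemAt_diag M a hu _ _ _
  · rw [h0, h2, h3]; linear_combination pf_riem_l3_34 M a hu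
  · rw [hsk (𝔣 0) (𝔣 2) (𝔣 3) (𝔣 0), h0, h2, h3]; linear_combination -pf_riem_l3_l4 M a hu
  · rw [hsk (𝔣 0) (𝔣 2) (𝔣 3) (𝔣 1), h0, h1, h2, h3]; linear_combination -pf_riem_l3_n4 M a hu
  · rw [hsk (𝔣 0) (𝔣 2) (𝔣 3) (𝔣 2), h0, h2, h3]; linear_combination -pf_riem_l3_34 M a hu
  · exact apply_riemAt_diag M a hu _ _ _

/-- **Full table of lowered frame components of `R(l,e₄)`**: `g(R(f_0,f_3) f_q, f_k)` (rows `k`,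
columns `q`) in the principal frame `(f_0, f_1, f_2, f_3) = (l, n, e₃, e₄)` of Kerr, ingoing Kerr
coordinates (`r = u 1`, `μ = u 2`), by the curvature symmetries. [cite: ONeill1983, Ch. 3, Prop. 3.36] -/
theorem pf_low_l4 (hu : u ∈ regularSet a) (𝔣 : Fin 4 → E4)
    (h0 : 𝔣 0 =
      (!₂[u 1 ^ 2 + 2 * M * u 1 + a ^ 2, u 1 ^ 2 - 2 * M * u 1 + a ^ 2, (0 : ℝ), 2 * a] : E4))
    (h1 : 𝔣 1 = (!₂[(1 : ℝ), -1, 0, 0] : E4)) (h2 : 𝔣 2 = (!₂[(0 : ℝ), 0, 1 - u 2 ^ 2, 0] : E4))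
    (h3 : 𝔣 3 = (!₂[a * (1 - u 2 ^ 2), (0 : ℝ), 0, 1] : E4)) (k q : Fin 4) :
    bilin M a u (riemAt (bilin M a) u (𝔣 0) (𝔣 3) (𝔣 q)) (𝔣 k) =
      (!![0, 0, 0, 0;
        0, 0,
          -(2 * M * (3 * u 1 ^ (2 : ℕ) * a * u 2 - a ^ (3 : ℕ) * u 2 ^ (3 : ℕ)) * (1 - u 2 ^ (2 : ℕ))) / sigma a u,
          2 * M * (u 1 ^ (3 : ℕ) - 3 * u 1 * a ^ (2 : ℕ) * u 2 ^ (2 : ℕ)) * (1 - u 2 ^ (2 : ℕ)) / sigma a u;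
        0,
          2 * M * (3 * u 1 ^ (2 : ℕ) * a * u 2 - a ^ (3 : ℕ) * u 2 ^ (3 : ℕ)) * (1 - u 2 ^ (2 : ℕ)) / sigma a u,
          0, 0;
        0,
          -(2 * M * (u 1 ^ (3 : ℕ) - 3 * u 1 * a ^ (2 : ℕ) * u 2 ^ (2 : ℕ)) * (1 - u 2 ^ (2 : ℕ))) / sigma a u,
          0, 0] : Matrix (Fin 4) (Fin 4) ℝ) k q := by
  have hsk := (isMetricOn_bilin M a).apply_riemAt_swap hu
  have hpc := (isMetricOn_bilin M a).apply_riemAt_pair_comm hu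
  fin_cases k <;> fin_cases q <;>
    simp only [Fin.zero_eta, Fin.mk_one, Fin.reduceFinMk, Fin.isValue, Matrix.of_apply,
      Matrix.cons_val', Matrix.cons_val_zero, Matrix.cons_val_one, Matrix.cons_val,
      Matrix.empty_val', Matrix.cons_val_fin_one]
  · exact apply_riemAt_diag M a hu _ _ _
  · rw [hpc (𝔣 0) (𝔣 3) (𝔣 1) (𝔣 0), riemAt_swap (bilin M a) u (𝔣 0) (𝔣 1), neg_apply, map_neg,
      neg_apply, hsk (𝔣 0) (𝔣 1) (𝔣 3) (𝔣 0), neg_neg, h0, h1, h3]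
    linear_combination pf_riem_ln_l4 M a hu
  · rw [hpc (𝔣 0) (𝔣 3) (𝔣 2) (𝔣 0), riemAt_swap (bilin M a) u (𝔣 0) (𝔣 2), neg_apply, map_neg,
      neg_apply, hsk (𝔣 0) (𝔣 2) (𝔣 3) (𝔣 0), neg_neg, h0, h2, h3]
    linear_combination pf_riem_l3_l4 M a hu
  · rw [h0, h3]; linear_combination pf_riem_l4_l4 M a hu
  · rw [hsk (𝔣 0) (𝔣 3) (𝔣 1) (𝔣 0), hpc (𝔣 0) (𝔣 3) (𝔣 1) (𝔣 0),
      riemAt_swap (bilin M a) u (𝔣 0) (𝔣 1), neg_apply, map_neg, neg_apply,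
      hsk (𝔣 0) (𝔣 1) (𝔣 3) (𝔣 0), neg_neg, h0, h1, h3]
    linear_combination -pf_riem_ln_l4 M a hu
  · exact apply_riemAt_diag M a hu _ _ _
  · rw [h0, h1, h2, h3]; linear_combination pf_riem_l4_n3 M a hu
  · rw [h0, h1, h3]; linear_combination pf_riem_l4_n4 M a hu
  · rw [hsk (𝔣 0) (𝔣 3) (𝔣 2) (𝔣 0), hpc (𝔣 0) (𝔣 3) (𝔣 2) (𝔣 0),
      riemAt_swap (bilin M a) u (𝔣 0) (𝔣 2), neg_apply, map_neg, neg_apply,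
      hsk (𝔣 0) (𝔣 2) (𝔣 3) (𝔣 0), neg_neg, h0, h2, h3]
    linear_combination -pf_riem_l3_l4 M a hu
  · rw [hsk (𝔣 0) (𝔣 3) (𝔣 2) (𝔣 1), h0, h1, h2, h3]; linear_combination -pf_riem_l4_n3 M a hu
  · exact apply_riemAt_diag M a hu _ _ _
  · rw [h0, h2, h3]; linear_combination pf_riem_l4_34 M a hu
  · rw [hsk (𝔣 0) (𝔣 3) (𝔣 3) (𝔣 0), h0, h3]; linear_combination -pf_riem_l4_l4 M a hu
  · rw [hsk (𝔣 0) (𝔣 3) (𝔣 3) (𝔣 1), h0, h1, h3]; linear_combination -pf_riem_l4_n4 M a hu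
  · rw [hsk (𝔣 0) (𝔣 3) (𝔣 3) (𝔣 2), h0, h2, h3]; linear_combination -pf_riem_l4_34 M a hu
  · exact apply_riemAt_diag M a hu _ _ _

/-- **Full table of lowered frame components of `R(n,e₃)`**: `g(R(f_1,f_2) f_q, f_k)` (rows `k`,
columns `q`) in the principal frame `(f_0, f_1, f_2, f_3) = (l, n, e₃, e₄)` of Kerr, ingoing Kerr
coordinates (`r = u 1`, `μ = u 2`), by the curvature symmetries. [cite: ONeill1983, Ch. 3, Prop. 3.36] -/
theorem pf_low_n3 (hu : u ∈ regularSet a) (𝔣 : Fin 4 → E4)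
    (h0 : 𝔣 0 =
      (!₂[u 1 ^ 2 + 2 * M * u 1 + a ^ 2, u 1 ^ 2 - 2 * M * u 1 + a ^ 2, (0 : ℝ), 2 * a] : E4))
    (h1 : 𝔣 1 = (!₂[(1 : ℝ), -1, 0, 0] : E4)) (h2 : 𝔣 2 = (!₂[(0 : ℝ), 0, 1 - u 2 ^ 2, 0] : E4))
    (h3 : 𝔣 3 = (!₂[a * (1 - u 2 ^ 2), (0 : ℝ), 0, 1] : E4)) (k q : Fin 4) :
    bilin M a u (riemAt (bilin M a) u (𝔣 1) (𝔣 2) (𝔣 q)) (𝔣 k) =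
      (!![0, 0,
          2 * M * (u 1 ^ (3 : ℕ) - 3 * u 1 * a ^ (2 : ℕ) * u 2 ^ (2 : ℕ)) * (1 - u 2 ^ (2 : ℕ)) / sigma a u,
          -(2 * M * (3 * u 1 ^ (2 : ℕ) * a * u 2 - a ^ (3 : ℕ) * u 2 ^ (3 : ℕ)) * (1 - u 2 ^ (2 : ℕ))) / sigma a u;
        0, 0, 0, 0;
        -(2 * M * (u 1 ^ (3 : ℕ) - 3 * u 1 * a ^ (2 : ℕ) * u 2 ^ (2 : ℕ)) * (1 - u 2 ^ (2 : ℕ))) / sigma a u,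
          0, 0, 0;
        2 * M * (3 * u 1 ^ (2 : ℕ) * a * u 2 - a ^ (3 : ℕ) * u 2 ^ (3 : ℕ)) * (1 - u 2 ^ (2 : ℕ)) / sigma a u,
          0, 0, 0] : Matrix (Fin 4) (Fin 4) ℝ) k q := by
  have hsk := (isMetricOn_bilin M a).apply_riemAt_swap hu
  have hpc := (isMetricOn_bilin M a).apply_riemAt_pair_comm hu
  fin_cases k <;> fin_cases q <;>
    simp only [Fin.zero_eta, Fin.mk_one, Fin.reduceFinMk, Fin.isValue, Matrix.of_apply,
      Matrix.cons_val', Matrix.cons_val_zero, Matrix.cons_val_one, Matrix.cons_val,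
      Matrix.empty_val', Matrix.cons_val_fin_one]
  · exact apply_riemAt_diag M a hu _ _ _
  · rw [hpc (𝔣 1) (𝔣 2) (𝔣 1) (𝔣 0), riemAt_swap (bilin M a) u (𝔣 0) (𝔣 1), neg_apply, map_neg,
      neg_apply, hsk (𝔣 0) (𝔣 1) (𝔣 2) (𝔣 1), neg_neg, h0, h1, h2]
    linear_combination pf_riem_ln_n3 M a hu
  · rw [hpc (𝔣 1) (𝔣 2) (𝔣 2) (𝔣 0), riemAt_swap (bilin M a) u (𝔣 0) (𝔣 2), neg_apply, map_neg,
      neg_apply, hsk (𝔣 0) (𝔣 2) (𝔣 2) (𝔣 1), neg_neg, h0, h1, h2]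
    linear_combination pf_riem_l3_n3 M a hu
  · rw [hpc (𝔣 1) (𝔣 2) (𝔣 3) (𝔣 0), riemAt_swap (bilin M a) u (𝔣 0) (𝔣 3), neg_apply, map_neg,
      neg_apply, hsk (𝔣 0) (𝔣 3) (𝔣 2) (𝔣 1), neg_neg, h0, h1, h2, h3]
    linear_combination pf_riem_l4_n3 M a hu
  · rw [hsk (𝔣 1) (𝔣 2) (𝔣 1) (𝔣 0), hpc (𝔣 1) (𝔣 2) (𝔣 1) (𝔣 0),
      riemAt_swap (bilin M a) u (𝔣 0) (𝔣 1), neg_apply, map_neg, neg_apply,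
      hsk (𝔣 0) (𝔣 1) (𝔣 2) (𝔣 1), neg_neg, h0, h1, h2]
    linear_combination -pf_riem_ln_n3 M a hu
  · exact apply_riemAt_diag M a hu _ _ _
  · rw [h1, h2]; linear_combination pf_riem_n3_n3 M a hu
  · rw [h1, h2, h3]; linear_combination pf_riem_n3_n4 M a hu
  · rw [hsk (𝔣 1) (𝔣 2) (𝔣 2) (𝔣 0), hpc (𝔣 1) (𝔣 2) (𝔣 2) (𝔣 0),
      riemAt_swap (bilin M a) u (𝔣 0) (𝔣 2), neg_apply, map_neg, neg_apply,
      hsk (𝔣 0) (𝔣 2) (𝔣 2) (𝔣 1), neg_neg, h0, h1, h2]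
    linear_combination -pf_riem_l3_n3 M a hu
  · rw [hsk (𝔣 1) (𝔣 2) (𝔣 2) (𝔣 1), h1, h2]; linear_combination -pf_riem_n3_n3 M a hu
  · exact apply_riemAt_diag M a hu _ _ _
  · rw [h1, h2, h3]; linear_combination pf_riem_n3_34 M a hu
  · rw [hsk (𝔣 1) (𝔣 2) (𝔣 3) (𝔣 0), hpc (𝔣 1) (𝔣 2) (𝔣 3) (𝔣 0),
      riemAt_swap (bilin M a) u (𝔣 0) (𝔣 3), neg_apply, map_neg, neg_apply,
      hsk (𝔣 0) (𝔣 3) (𝔣 2) (𝔣 1), neg_neg, h0, h1, h2, h3]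
    linear_combination -pf_riem_l4_n3 M a hu
  · rw [hsk (𝔣 1) (𝔣 2) (𝔣 3) (𝔣 1), h1, h2, h3]; linear_combination -pf_riem_n3_n4 M a hu
  · rw [hsk (𝔣 1) (𝔣 2) (𝔣 3) (𝔣 2), h1, h2, h3]; linear_combination -pf_riem_n3_34 M a hu
  · exact apply_riemAt_diag M a hu _ _ _

/-- **Full table of lowered frame components of `R(n,e₄)`**: `g(R(f_1,f_3) f_q, f_k)` (rows `k`,
columns `q`) in the principal frame `(f_0, f_1, f_2, f_3) = (l, n, e₃, e₄)` of Kerr, ingoing Kerr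
coordinates (`r = u 1`, `μ = u 2`), by the curvature symmetries. [cite: ONeill1983, Ch. 3, Prop. 3.36] -/
theorem pf_low_n4 (hu : u ∈ regularSet a) (𝔣 : Fin 4 → E4)
    (h0 : 𝔣 0 =
      (!₂[u 1 ^ 2 + 2 * M * u 1 + a ^ 2, u 1 ^ 2 - 2 * M * u 1 + a ^ 2, (0 : ℝ), 2 * a] : E4))
    (h1 : 𝔣 1 = (!₂[(1 : ℝ), -1, 0, 0] : E4)) (h2 : 𝔣 2 = (!₂[(0 : ℝ), 0, 1 - u 2 ^ 2, 0] : E4))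
    (h3 : 𝔣 3 = (!₂[a * (1 - u 2 ^ 2), (0 : ℝ), 0, 1] : E4)) (k q : Fin 4) :
    bilin M a u (riemAt (bilin M a) u (𝔣 1) (𝔣 3) (𝔣 q)) (𝔣 k) =
      (!![0, 0,
          2 * M * (3 * u 1 ^ (2 : ℕ) * a * u 2 - a ^ (3 : ℕ) * u 2 ^ (3 : ℕ)) * (1 - u 2 ^ (2 : ℕ)) / sigma a u,
          2 * M * (u 1 ^ (3 : ℕ) - 3 * u 1 * a ^ (2 : ℕ) * u 2 ^ (2 : ℕ)) * (1 - u 2 ^ (2 : ℕ)) / sigma a u;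
        0, 0, 0, 0;
        -(2 * M * (3 * u 1 ^ (2 : ℕ) * a * u 2 - a ^ (3 : ℕ) * u 2 ^ (3 : ℕ)) * (1 - u 2 ^ (2 : ℕ))) / sigma a u,
          0, 0, 0;
        -(2 * M * (u 1 ^ (3 : ℕ) - 3 * u 1 * a ^ (2 : ℕ) * u 2 ^ (2 : ℕ)) * (1 - u 2 ^ (2 : ℕ))) / sigma a u,
          0, 0, 0] : Matrix (Fin 4) (Fin 4) ℝ) k q := by
  have hsk := (isMetricOn_bilin M a).apply_riemAt_swap hu
  have hpc := (isMetricOn_bilin M a).apply_riemAt_pair_comm hu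
  fin_cases k <;> fin_cases q <;>
    simp only [Fin.zero_eta, Fin.mk_one, Fin.reduceFinMk, Fin.isValue, Matrix.of_apply,
      Matrix.cons_val', Matrix.cons_val_zero, Matrix.cons_val_one, Matrix.cons_val,
      Matrix.empty_val', Matrix.cons_val_fin_one]
  · exact apply_riemAt_diag M a hu _ _ _
  · rw [hpc (𝔣 1) (𝔣 3) (𝔣 1) (𝔣 0), riemAt_swap (bilin M a) u (𝔣 0) (𝔣 1), neg_apply, map_neg,
      neg_apply, hsk (𝔣 0) (𝔣 1) (𝔣 3) (𝔣 1), neg_neg, h0, h1, h3]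
    linear_combination pf_riem_ln_n4 M a hu
  · rw [hpc (𝔣 1) (𝔣 3) (𝔣 2) (𝔣 0), riemAt_swap (bilin M a) u (𝔣 0) (𝔣 2), neg_apply, map_neg,
      neg_apply, hsk (𝔣 0) (𝔣 2) (𝔣 3) (𝔣 1), neg_neg, h0, h1, h2, h3]
    linear_combination pf_riem_l3_n4 M a hu
  · rw [hpc (𝔣 1) (𝔣 3) (𝔣 3) (𝔣 0), riemAt_swap (bilin M a) u (𝔣 0) (𝔣 3), neg_apply, map_neg,
      neg_apply, hsk (𝔣 0) (𝔣 3) (𝔣 3) (𝔣 1), neg_neg, h0, h1, h3]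
    linear_combination pf_riem_l4_n4 M a hu
  · rw [hsk (𝔣 1) (𝔣 3) (𝔣 1) (𝔣 0), hpc (𝔣 1) (𝔣 3) (𝔣 1) (𝔣 0),
      riemAt_swap (bilin M a) u (𝔣 0) (𝔣 1), neg_apply, map_neg, neg_apply,
      hsk (𝔣 0) (𝔣 1) (𝔣 3) (𝔣 1), neg_neg, h0, h1, h3]
    linear_combination -pf_riem_ln_n4 M a hu
  · exact apply_riemAt_diag M a hu _ _ _
  · rw [hpc (𝔣 1) (𝔣 3) (𝔣 2) (𝔣 1), riemAt_swap (bilin M a) u (𝔣 1) (𝔣 2), neg_apply, map_neg,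
      neg_apply, hsk (𝔣 1) (𝔣 2) (𝔣 3) (𝔣 1), neg_neg, h1, h2, h3]
    linear_combination pf_riem_n3_n4 M a hu
  · rw [h1, h3]; linear_combination pf_riem_n4_n4 M a hu
  · rw [hsk (𝔣 1) (𝔣 3) (𝔣 2) (𝔣 0), hpc (𝔣 1) (𝔣 3) (𝔣 2) (𝔣 0),
      riemAt_swap (bilin M a) u (𝔣 0) (𝔣 2), neg_apply, map_neg, neg_apply,
      hsk (𝔣 0) (𝔣 2) (𝔣 3) (𝔣 1), neg_neg, h0, h1, h2, h3]
    linear_combination -pf_riem_l3_n4 M a hu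
  · rw [hsk (𝔣 1) (𝔣 3) (𝔣 2) (𝔣 1), hpc (𝔣 1) (𝔣 3) (𝔣 2) (𝔣 1),
      riemAt_swap (bilin M a) u (𝔣 1) (𝔣 2), neg_apply, map_neg, neg_apply,
      hsk (𝔣 1) (𝔣 2) (𝔣 3) (𝔣 1), neg_neg, h1, h2, h3]
    linear_combination -pf_riem_n3_n4 M a hu
  · exact apply_riemAt_diag M a hu _ _ _
  · rw [h1, h2, h3]; linear_combination pf_riem_n4_34 M a hu
  · rw [hsk (𝔣 1) (𝔣 3) (𝔣 3) (𝔣 0), hpc (𝔣 1) (𝔣 3) (𝔣 3) (𝔣 0),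
      riemAt_swap (bilin M a) u (𝔣 0) (𝔣 3), neg_apply, map_neg, neg_apply,
      hsk (𝔣 0) (𝔣 3) (𝔣 3) (𝔣 1), neg_neg, h0, h1, h3]
    linear_combination -pf_riem_l4_n4 M a hu
  · rw [hsk (𝔣 1) (𝔣 3) (𝔣 3) (𝔣 1), h1, h3]; linear_combination -pf_riem_n4_n4 M a hu
  · rw [hsk (𝔣 1) (𝔣 3) (𝔣 3) (𝔣 2), h1, h2, h3]; linear_combination -pf_riem_n4_34 M a hu
  · exact apply_riemAt_diag M a hu _ _ _

/-- **Full table of lowered frame components of `R(e₃,e₄)`**: `g(R(f_2,f_3) f_q, f_k)` (rows `k`,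
columns `q`) in the principal frame `(f_0, f_1, f_2, f_3) = (l, n, e₃, e₄)` of Kerr, ingoing Kerr
coordinates (`r = u 1`, `μ = u 2`), by the curvature symmetries. [cite: ONeill1983, Ch. 3, Prop. 3.36] -/
theorem pf_low_34 (hu : u ∈ regularSet a) (𝔣 : Fin 4 → E4)
    (h0 : 𝔣 0 =
      (!₂[u 1 ^ 2 + 2 * M * u 1 + a ^ 2, u 1 ^ 2 - 2 * M * u 1 + a ^ 2, (0 : ℝ), 2 * a] : E4))
    (h1 : 𝔣 1 = (!₂[(1 : ℝ), -1, 0, 0] : E4)) (h2 : 𝔣 2 = (!₂[(0 : ℝ), 0, 1 - u 2 ^ 2, 0] : E4))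
    (h3 : 𝔣 3 = (!₂[a * (1 - u 2 ^ 2), (0 : ℝ), 0, 1] : E4)) (k q : Fin 4) :
    bilin M a u (riemAt (bilin M a) u (𝔣 2) (𝔣 3) (𝔣 q)) (𝔣 k) =
      (!![0,
          4 * M * (3 * u 1 ^ (2 : ℕ) * a * u 2 - a ^ (3 : ℕ) * u 2 ^ (3 : ℕ)) * (1 - u 2 ^ (2 : ℕ)) / sigma a u,
          0, 0;
        -(4 * M * (3 * u 1 ^ (2 : ℕ) * a * u 2 - a ^ (3 : ℕ) * u 2 ^ (3 : ℕ)) * (1 - u 2 ^ (2 : ℕ))) / sigma a u,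
          0, 0, 0;
        0, 0, 0,
          2 * M * (u 1 ^ (3 : ℕ) - 3 * u 1 * a ^ (2 : ℕ) * u 2 ^ (2 : ℕ)) * (1 - u 2 ^ (2 : ℕ)) ^ (2 : ℕ) / sigma a u;
        0, 0,
          -(2 * M * (u 1 ^ (3 : ℕ) - 3 * u 1 * a ^ (2 : ℕ) * u 2 ^ (2 : ℕ)) * (1 - u 2 ^ (2 : ℕ)) ^ (2 : ℕ)) / sigma a u,
          0] : Matrix (Fin 4) (Fin 4) ℝ) k q := by
  have hsk := (isMetricOn_bilin M a).apply_riemAt_swap hu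
  have hpc := (isMetricOn_bilin M a).apply_riemAt_pair_comm hu
  fin_cases k <;> fin_cases q <;>
    simp only [Fin.zero_eta, Fin.mk_one, Fin.reduceFinMk, Fin.isValue, Matrix.of_apply,
      Matrix.cons_val', Matrix.cons_val_zero, Matrix.cons_val_one, Matrix.cons_val,
      Matrix.empty_val', Matrix.cons_val_fin_one]
  · exact apply_riemAt_diag M a hu _ _ _
  · rw [hpc (𝔣 2) (𝔣 3) (𝔣 1) (𝔣 0), riemAt_swap (bilin M a) u (𝔣 0) (𝔣 1), neg_apply, map_neg,
      neg_apply, hsk (𝔣 0) (𝔣 1) (𝔣 3) (𝔣 2), neg_neg, h0, h1, h2, h3]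
    linear_combination pf_riem_ln_34 M a hu
  · rw [hpc (𝔣 2) (𝔣 3) (𝔣 2) (𝔣 0), riemAt_swap (bilin M a) u (𝔣 0) (𝔣 2), neg_apply, map_neg,
      neg_apply, hsk (𝔣 0) (𝔣 2) (𝔣 3) (𝔣 2), neg_neg, h0, h2, h3]
    linear_combination pf_riem_l3_34 M a hu
  · rw [hpc (𝔣 2) (𝔣 3) (𝔣 3) (𝔣 0), riemAt_swap (bilin M a) u (𝔣 0) (𝔣 3), neg_apply, map_neg,
      neg_apply, hsk (𝔣 0) (𝔣 3) (𝔣 3) (𝔣 2), neg_neg, h0, h2, h3]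
    linear_combination pf_riem_l4_34 M a hu
  · rw [hsk (𝔣 2) (𝔣 3) (𝔣 1) (𝔣 0), hpc (𝔣 2) (𝔣 3) (𝔣 1) (𝔣 0),
      riemAt_swap (bilin M a) u (𝔣 0) (𝔣 1), neg_apply, map_neg, neg_apply,
      hsk (𝔣 0) (𝔣 1) (𝔣 3) (𝔣 2), neg_neg, h0, h1, h2, h3]
    linear_combination -pf_riem_ln_34 M a hu
  · exact apply_riemAt_diag M a hu _ _ _
  · rw [hpc (𝔣 2) (𝔣 3) (𝔣 2) (𝔣 1), riemAt_swap (bilin M a) u (𝔣 1) (𝔣 2), neg_apply, map_neg,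
      neg_apply, hsk (𝔣 1) (𝔣 2) (𝔣 3) (𝔣 2), neg_neg, h1, h2, h3]
    linear_combination pf_riem_n3_34 M a hu
  · rw [hpc (𝔣 2) (𝔣 3) (𝔣 3) (𝔣 1), riemAt_swap (bilin M a) u (𝔣 1) (𝔣 3), neg_apply, map_neg,
      neg_apply, hsk (𝔣 1) (𝔣 3) (𝔣 3) (𝔣 2), neg_neg, h1, h2, h3]
    linear_combination pf_riem_n4_34 M a hu
  · rw [hsk (𝔣 2) (𝔣 3) (𝔣 2) (𝔣 0), hpc (𝔣 2) (𝔣 3) (𝔣 2) (𝔣 0),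
      riemAt_swap (bilin M a) u (𝔣 0) (𝔣 2), neg_apply, map_neg, neg_apply,
      hsk (𝔣 0) (𝔣 2) (𝔣 3) (𝔣 2), neg_neg, h0, h2, h3]
    linear_combination -pf_riem_l3_34 M a hu
  · rw [hsk (𝔣 2) (𝔣 3) (𝔣 2) (𝔣 1), hpc (𝔣 2) (𝔣 3) (𝔣 2) (𝔣 1),
      riemAt_swap (bilin M a) u (𝔣 1) (𝔣 2), neg_apply, map_neg, neg_apply,
      hsk (𝔣 1) (𝔣 2) (𝔣 3) (𝔣 2), neg_neg, h1, h2, h3]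
    linear_combination -pf_riem_n3_34 M a hu
  · exact apply_riemAt_diag M a hu _ _ _
  · rw [h2, h3]; linear_combination pf_riem_34_34 M a hu
  · rw [hsk (𝔣 2) (𝔣 3) (𝔣 3) (𝔣 0), hpc (𝔣 2) (𝔣 3) (𝔣 3) (𝔣 0),
      riemAt_swap (bilin M a) u (𝔣 0) (𝔣 3), neg_apply, map_neg, neg_apply,
      hsk (𝔣 0) (𝔣 3) (𝔣 3) (𝔣 2), neg_neg, h0, h2, h3]
    linear_combination -pf_riem_l4_34 M a hu
  · rw [hsk (𝔣 2) (𝔣 3) (𝔣 3) (𝔣 1), hpc (𝔣 2) (𝔣 3) (𝔣 3) (𝔣 1),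
      riemAt_swap (bilin M a) u (𝔣 1) (𝔣 3), neg_apply, map_neg, neg_apply,
      hsk (𝔣 1) (𝔣 3) (𝔣 3) (𝔣 2), neg_neg, h1, h2, h3]
    linear_combination -pf_riem_n4_34 M a hu
  · rw [hsk (𝔣 2) (𝔣 3) (𝔣 3) (𝔣 2), h2, h3]; linear_combination -pf_riem_34_34 M a hu
  · exact apply_riemAt_diag M a hu _ _ _

end Ingoing

end Kerr

end Literature.Geometry.Lorentzian

end
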